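import Summits.HubbardSuperconductivity.HubbardSuperconductivity.Theorems.BalabanIRBirBdGPhaseCoercivityFirstOrder

/-!
# Route BalabanIR — crux 3 `BirBdGPhaseCoercivity` (item `stmt-HubbardSuperconductivity-2081`):
# the a-priori CEILING on the coercivity constant

Consequences of the first-order bound of file `…FirstOrder` for the crux's objects:
* `hb_isHermitian` — the crux's BdG matrix `Hb(θ)` is Hermitian for every texture (its `∀ hθ h0`
  binders are inhabited);
* `deficit_le_condensation_norm` — the `U(1)`-sharp form `… ≤ 2(Σ_k|Δ_k|²/E_k)(1 - |Σ_x e^{iθ_x}|/L²)`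
  (reference angle `α = arg Σ_x e^{iθ_x}`), and `deficit_le_two_condensation` — the texture-free form
  `Σ|λ(Hb(0))| - Σ|λ(Hb(θ))| ≤ 2 Σ_k |Δ_k|²/E_k` for EVERY texture;
* `xy_stagger` — the staggered texture `e^{iθ} = χ_{(L/2,L/2)}` (even `L`) twists every
  nearest-neighbour bond maximally: XY cost `8L²`;
* `ceiling_of_coercive`, `ceiling_explicit`, `birBdG_constant_le` — if the conclusion of
  `BirBdGPhaseCoercivity` holds at `(μ,Δ₁,Δ₂)` with constant `c₀` (from some side on), then
  `8 c₀ L² ≤ 2 Σ_k |Δ_k|²/E_k` at every even side `L ≥ 4`, hence `c₀ ≤ |Δ₁| + |Δ₂|`: the crux's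
  constant necessarily degenerates in the weak-coupling regime `Δ → 0` (in truth like
  `κ/4 ~ Δ² log(1/Δ)`, `κ = L⁻²Σ_k|Δ_k|²/E_k`; numerically the staggered texture realises about
  `0.6 κ/4`, evidence `work/compute2081` on the item);
* `not_uniform_constant` — the natural strengthening "one `c₀ > 0` for all `(μ,Δ₁,Δ₂)`" is FALSE
  (take `Δ₁ = Δ₂ = c₀/4`).

References: crux idea `sqrt-concavity-multiplier` (the ceiling `c₀ ≤ κ/4`), refuter route-review note
on the item (`c₀ ≤ |Δ₁| + |Δ₂|`). No definition is introduced.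
-/

noncomputable section

namespace Summit.HubbardSuperconductivity.HubbardSuperconductivity.Theorems

namespace BirBdG

open Matrix Finset Literature.Probability.LatticeModels
open scoped ComplexConjugate ComplexOrder

section Typed

variable {L : ℕ} [NeZero L]

/-- **`U(1)`-sharp form of the first-order bound**: for every texture,
`Σ_i|λ_i(Hb(0))| - Σ_i|λ_i(Hb(θ))| ≤ 2 (Σ_k |Δ_k|²/E_k) · (1 - |Σ_x e^{iθ_x}|/L²)` — the reference angle
`α = arg Σ_x e^{iθ_x}` in `deficit_le_condensation` gives `Σ_x cos(θ_x - α) = |Σ_x e^{iθ_x}|`. The deficit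
is controlled by the deficit of the modulus of the mean order parameter. [folklore] -/
theorem deficit_le_condensation_norm (μ Δ₁ Δ₂ : ℝ) (hL : 3 ≤ L) (hμ : μ ∈ Set.Ioo (-4 : ℝ) 4)
    (h₁ : Δ₁ ≠ 0) (h₂ : Δ₂ ≠ 0) (ξ E : TorusSite 2 L → ℝ) (Δ : TorusSite 2 L → ℂ)
    (hξ : ∀ k, ξ k = -2 * Real.cos (latticeMomentum L k 0) - 2 * Real.cos (latticeMomentum L k 1) - μ)
    (hΔ : ∀ k, Δ k = ((2 * Δ₁ * (Real.cos (latticeMomentum L k 0) - Real.cos (latticeMomentum L k 1)) : ℝ) : ℂ) -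
        4 * Complex.I * ((Δ₂ * Real.sin (latticeMomentum L k 0) * Real.sin (latticeMomentum L k 1) : ℝ) : ℂ))
    (hE : ∀ k, E k = Real.sqrt (ξ k ^ 2 + ‖Δ k‖ ^ 2)) :
    let nnx : Literature.Probability.LatticeModels.TorusSite 2 L → Literature.Probability.LatticeModels.TorusSite 2 L → Prop := fun x y => y = x + ![1, 0] ∨ y = x + ![-1, 0]; let nny : Literature.Probability.LatticeModels.TorusSite 2 L → Literature.Probability.LatticeModels.TorusSite 2 L → Prop := fun x y => y = x + ![0, 1] ∨ y = x + ![0, -1]; let dg1 : Literature.Probability.LatticeModels.TorusSite 2 L → Literature.Probability.LatticeModels.TorusSite 2 L → Prop := fun x y => y = x + ![1, 1] ∨ y = x + ![-1, -1]; let dg2 : Literature.Probability.LatticeModels.TorusSite 2 L → Literature.Probability.LatticeModels.TorusSite 2 L → Prop := fun x y => y = x + ![1, -1] ∨ y = x + ![-1, 1]; let h : Matrix (Literature.Probability.LatticeModels.TorusSite 2 L) (Literature.Probability.LatticeModels.TorusSite 2 L) ℂ := fun x y => -(if nnx x y ∨ nny x y then (1 : ℂ) else 0) - (if x = y then (μ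 : ℂ) else 0); let D : (Literature.Probability.LatticeModels.TorusSite 2 L → ℝ) → Matrix (Literature.Probability.LatticeModels.TorusSite 2 L) (Literature.Probability.LatticeModels.TorusSite 2 L) ℂ := fun θ x y => ((Δ₁ : ℂ) * ((if nnx x y then (1 : ℂ) else 0) - (if nny x y then (1 : ℂ) else 0)) + Complex.I * (Δ₂ : ℂ) * ((if dg1 x y then (1 : ℂ) else 0) - (if dg2 x y then (1 : ℂ) else 0))) * (Complex.exp (Complex.I * (θ x : ℂ)) + Complex.exp (Complex.I * (θ y : ℂ))) / 2; let Hb : (Literature.Probability.LatticeModels.TorusSite 2 L → ℝ) → Matrix (Literature.Probability.LatticeModels.TorusSite 2 L ⊕ Literature.Probability.LatticeModels.TorusSite 2 L) (Literature.Probability.LatticeModels.TorusSite 2 L ⊕ Literature.Probability.LatticeModels.TorusSite 2 L) ℂ := fun θ => Matrix.fromBlocks h (D θ) (Matrix.conjTranspose (D θ)) (-h); ∀ θ : Literature.Probability.LatticeModels.TorusSite 2 L → ℝ, ∀ (hθ : (Hb θ).IsHermitian) (h0 : (Hb (fun _ => 0)).IsHermitian), ∑ i, |h0.eigenvalues i|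 - ∑ i, |hθ.eigenvalues i| ≤ 2 * (∑ k, ‖Δ k‖ ^ 2 / E k) * (1 - ‖∑ x, Complex.exp (Complex.I * (θ x : ℂ))‖ / ((L ^ 2 : ℕ) : ℝ)) := by
  intro nnx nny dg1 dg2 h D Hb θ hθ h0
  set z : ℂ := ∑ x, Complex.exp (Complex.I * (θ x : ℂ)) with hz
  have main := deficit_le_condensation μ Δ₁ Δ₂ (Complex.arg z) hL hμ h₁ h₂ ξ E Δ hξ hΔ hE θ hθ h0
  -- `Σ_x cos(θ_x - arg z) = ‖z‖`
  have hsum : ∑ x, Real.cos (θ x - Complex.arg z) = ‖z‖ := by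
    have h1 : (∑ x, Real.cos (θ x - Complex.arg z) : ℝ) =
        (z * Complex.exp (-(Complex.arg z : ℂ) * Complex.I)).re := by
      rw [hz, Finset.sum_mul, Complex.re_sum]
      refine Finset.sum_congr rfl fun x _ => ?_
      rw [← Complex.exp_add, show Complex.I * (θ x : ℂ) + -(Complex.arg z : ℂ) * Complex.I =
        ((θ x - Complex.arg z : ℝ) : ℂ) * Complex.I by push_cast; ring, Complex.exp_ofReal_mul_I_re]
    rw [h1]
    have hpolar := Complex.norm_mul_exp_arg_mul_I z
    have h2 : z * Complex.exp (-(Complex.arg z : ℂ) * Complex.I) = (‖z‖ : ℂ) := by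
      calc z * Complex.exp (-(Complex.arg z : ℂ) * Complex.I)
          = (‖z‖ : ℂ) * Complex.exp (Complex.arg z * Complex.I) *
              Complex.exp (-(Complex.arg z : ℂ) * Complex.I) := by rw [hpolar]
        _ = (‖z‖ : ℂ) := by
            rw [mul_assoc, ← Complex.exp_add, show (Complex.arg z : ℂ) * Complex.I +
              -(Complex.arg z : ℂ) * Complex.I = 0 by ring, Complex.exp_zero, mul_one]
    rw [h2, Complex.ofReal_re]
  change ∑ i, |h0.eigenvalues i| - ∑ i, |hθ.eigenvalues i| ≤
    2 * (∑ k, ‖Δ k‖ ^ 2 / E k) * (1 - (∑ x, Real.cos (θ x - Complex.arg z)) / ((L ^ 2 : ℕ) : ℝ)) at main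
  rwa [hsum] at main

/-- **Texture-free form of the ceiling**: for `μ ∈ (-4,4)`, `Δ₁Δ₂ ≠ 0`, `L ≥ 3` and EVERY texture,
`Σ_i|λ_i(Hb(0))| - Σ_i|λ_i(Hb(θ))| ≤ 2 Σ_k |Δ_k|²/E_k`: no phase texture can gain more than the
condensation-type constant `2 Σ_k |Δ_k|²/E_k = O(L²)`, uniformly in the texture. [folklore] -/
theorem deficit_le_two_condensation (μ Δ₁ Δ₂ : ℝ) (hL : 3 ≤ L) (hμ : μ ∈ Set.Ioo (-4 : ℝ) 4)
    (h₁ : Δ₁ ≠ 0) (h₂ : Δ₂ ≠ 0) (ξ E : TorusSite 2 L → ℝ) (Δ : TorusSite 2 L → ℂ)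
    (hξ : ∀ k, ξ k = -2 * Real.cos (latticeMomentum L k 0) - 2 * Real.cos (latticeMomentum L k 1) - μ)
    (hΔ : ∀ k, Δ k = ((2 * Δ₁ * (Real.cos (latticeMomentum L k 0) - Real.cos (latticeMomentum L k 1)) : ℝ) : ℂ) -
        4 * Complex.I * ((Δ₂ * Real.sin (latticeMomentum L k 0) * Real.sin (latticeMomentum L k 1) : ℝ) : ℂ))
    (hE : ∀ k, E k = Real.sqrt (ξ k ^ 2 + ‖Δ k‖ ^ 2)) :
    let nnx : Literature.Probability.LatticeModels.TorusSite 2 L → Literature.Probability.LatticeModels.TorusSite 2 L → Prop := fun x y => y = x + ![1, 0] ∨ y = x + ![-1, 0]; let nny : Literature.Probability.LatticeModels.TorusSite 2 L → Literature.Probability.LatticeModels.TorusSite 2 L → Prop := fun x y => y = x + ![0, 1] ∨ y = x + ![0, -1]; let dg1 : Literature.Probability.LatticeModels.TorusSite 2 L → Literature.Probability.LatticeModels.TorusSite 2 L → Prop := fun x y => y = x + ![1, 1] ∨ y = x + ![-1, -1]; let dg2 : Literature.Probability.LatticeModels.TorusSite 2 L → Literature.Probability.LatticeModels.TorusSite 2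 L → Prop := fun x y => y = x + ![1, -1] ∨ y = x + ![-1, 1]; let h : Matrix (Literature.Probability.LatticeModels.TorusSite 2 L) (Literature.Probability.LatticeModels.TorusSite 2 L) ℂ := fun x y => -(if nnx x y ∨ nny x y then (1 : ℂ) else 0) - (if x = y then (μ : ℂ) else 0); let D : (Literature.Probability.LatticeModels.TorusSite 2 L → ℝ) → Matrix (Literature.Probability.LatticeModels.TorusSite 2 L) (Literature.Probability.LatticeModels.TorusSite 2 L) ℂ := fun θ x y => ((Δ₁ : ℂ) * ((if nnx x y then (1 : ℂ) else 0) - (if nny x y then (1 : ℂ) else 0)) + Complex.I * (Δ₂ : ℂ) * ((if dg1 x y then (1 : ℂ) else 0) - (if dg2 x y then (1 : ℂ) else 0))) * (Complex.exp (Complex.I * (θ x : ℂ)) + Complex.exp (Complex.I * (θ y : ℂ))) / 2; let Hb : (Literature.Probability.LatticeModels.TorusSite 2 L → ℝ) → Matrix (Literature.Probability.LatticeModels.TorusSite 2 L ⊕ Literature.Probability.LatticeModels.TorusSite 2 L) (Literature.Probability.LatticeModels.TorusSite 2 L ⊕ Literature.Probability.LatticeModels.TorusSite 2 L) ℂ :=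 fun θ => Matrix.fromBlocks h (D θ) (Matrix.conjTranspose (D θ)) (-h); ∀ θ : Literature.Probability.LatticeModels.TorusSite 2 L → ℝ, ∀ (hθ : (Hb θ).IsHermitian) (h0 : (Hb (fun _ => 0)).IsHermitian), ∑ i, |h0.eigenvalues i| - ∑ i, |hθ.eigenvalues i| ≤ 2 * ∑ k, ‖Δ k‖ ^ 2 / E k := by
  intro nnx nny dg1 dg2 h D Hb θ hθ h0
  have main := deficit_le_condensation_norm μ Δ₁ Δ₂ hL hμ h₁ h₂ ξ E Δ hξ hΔ hE θ hθ h0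
  have hEnn : ∀ k, 0 ≤ E k := fun k => by rw [hE]; exact Real.sqrt_nonneg _
  have hκ : 0 ≤ ∑ k, ‖Δ k‖ ^ 2 / E k :=
    Finset.sum_nonneg fun k _ => div_nonneg (sq_nonneg _) (hEnn k)
  have ht : 0 ≤ ‖∑ x, Complex.exp (Complex.I * (θ x : ℂ))‖ / ((L ^ 2 : ℕ) : ℝ) :=
    div_nonneg (norm_nonneg _) (by positivity)
  change ∑ i, |h0.eigenvalues i| - ∑ i, |hθ.eigenvalues i| ≤ 2 * (∑ k, ‖Δ k‖ ^ 2 / E k) *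
    (1 - ‖∑ x, Complex.exp (Complex.I * (θ x : ℂ))‖ / ((L ^ 2 : ℕ) : ℝ)) at main
  nlinarith [main, mul_nonneg hκ ht]

omit [NeZero L] in
/-- **The crux's BdG matrix is Hermitian** for every texture (so the `∀ hθ h0` binders of
`BirBdGPhaseCoercivity` are inhabited): the hopping block is real symmetric and the particle–hole
blocks are mutual adjoints by construction. [folklore] -/
theorem hb_isHermitian (μ Δ₁ Δ₂ : ℝ) :
    let nnx : Literature.Probability.LatticeModels.TorusSite 2 L → Literature.Probability.LatticeModels.TorusSite 2 L → Prop := fun x y => y = x + ![1, 0] ∨ y = x + ![-1, 0]; let nny : Literature.Probability.LatticeModels.TorusSite 2 L → Literature.Probability.LatticeModels.TorusSite 2 L → Prop := fun x y => y = x + ![0, 1] ∨ y = x + ![0, -1]; let dg1 : Literature.Probability.LatticeModels.TorusSite 2 L → Literature.Probability.LatticeModels.TorusSite 2 L → Prop := fun x y => y = x + ![1, 1] ∨ y = x + ![-1, -1]; let dg2 : Literature.Probability.LatticeModels.TorusSite 2 L → Literature.Probability.LatticeModels.TorusSite 2 L → Prop := fun x y => y = x + ![1, -1] ∨ y = x +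 ![-1, 1]; let h : Matrix (Literature.Probability.LatticeModels.TorusSite 2 L) (Literature.Probability.LatticeModels.TorusSite 2 L) ℂ := fun x y => -(if nnx x y ∨ nny x y then (1 : ℂ) else 0) - (if x = y then (μ : ℂ) else 0); let D : (Literature.Probability.LatticeModels.TorusSite 2 L → ℝ) → Matrix (Literature.Probability.LatticeModels.TorusSite 2 L) (Literature.Probability.LatticeModels.TorusSite 2 L) ℂ := fun θ x y => ((Δ₁ : ℂ) * ((if nnx x y then (1 : ℂ) else 0) - (if nny x y then (1 : ℂ) else 0)) + Complex.I * (Δ₂ : ℂ) * ((if dg1 x y then (1 : ℂ) else 0) - (if dg2 x y then (1 : ℂ) else 0))) * (Complex.exp (Complex.I * (θ x : ℂ)) + Complex.exp (Complex.I * (θ y : ℂ))) / 2; let Hb : (Literature.Probability.LatticeModels.TorusSite 2 L → ℝ) → Matrix (Literature.Probability.LatticeModels.TorusSite 2 L ⊕ Literature.Probability.LatticeModels.TorusSite 2 L) (Literature.Probability.LatticeModels.TorusSite 2 L ⊕ Literature.Probability.LatticeModels.TorusSite 2 L) ℂ := fun θ => Matrix.fromBlocks h (D θ) (Matrix.conjTranspose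 (D θ)) (-h); ∀ θ : Literature.Probability.LatticeModels.TorusSite 2 L → ℝ, (Hb θ).IsHermitian := by
  intro nnx nny dg1 dg2 h D Hb θ
  -- symmetry of the nearest-neighbour relation
  have hswap : ∀ x y : TorusSite 2 L, (nnx y x ∨ nny y x) ↔ (nnx x y ∨ nny x y) := by
    have key : ∀ (x y v : TorusSite 2 L), x = y + v ↔ y = x + -v := by
      intro x y v
      constructor
      · intro h; rw [h, add_neg_cancel_right]
      · intro h; rw [h, neg_add_cancel_right]
    intro x y
    change ((x = y + ![1, 0] ∨ x = y + ![-1, 0]) ∨ (x = y + ![0, 1] ∨ x = y + ![0, -1])) ↔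
      ((y = x + ![1, 0] ∨ y = x + ![-1, 0]) ∨ (y = x + ![0, 1] ∨ y = x + ![0, -1]))
    rw [key x y ![1, 0], key x y ![-1, 0], key x y ![0, 1], key x y ![0, -1], vec_neg10, vec_neg01,
      neg_neg, neg_neg]
    tauto
  have hh : h.IsHermitian := by
    refine Matrix.IsHermitian.ext fun x y => ?_
    change star (-(if (nnx y x ∨ nny y x) then (1 : ℂ) else 0) - (if y = x then (μ : ℂ) else 0)) =
      -(if (nnx x y ∨ nny x y) then (1 : ℂ) else 0) - (if x = y then (μ : ℂ) else 0)
    rw [star_sub, star_neg, apply_ite (star : ℂ → ℂ), apply_ite (star : ℂ → ℂ), star_one, star_zero,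
      Complex.star_def, Complex.conj_ofReal]
    simp only [hswap x y, eq_comm]
  change (Matrix.fromBlocks h (D θ) (D θ)ᴴ (-h)).IsHermitian
  exact Matrix.IsHermitian.fromBlocks hh rfl hh.neg


/-! ### The staggered texture and the ceiling on the coercivity constant -/

/-- A character of `(ℤ/L)^d` in exponential form: `χ_k(x) = exp(i Σᵢ pᵢ xᵢ.val)`, `p = 2πk/L`. [cite: FriedliVelenik2017, §10.4] -/
theorem torusChar_eq_exp' {d : ℕ} (k x : TorusSite d L) :
    torusChar k x = Complex.exp ((∑ i, latticeMomentum L k i * ((x i).val : ℝ) : ℝ) * Complex.I) := by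
  unfold torusChar
  simp_rw [stdAddChar_mul_eq_exp, ← Complex.exp_sum]
  congr 1
  push_cast
  rw [Finset.sum_mul]
  refine Finset.sum_congr rfl fun i _ => ?_
  simp only [latticeMomentum]
  push_cast
  ring

/-- Phase correlations of a character texture: if `θ_x = Σᵢ pᵢ(Q) xᵢ.val` (so `e^{iθ_x} = χ_Q(x)`), then
`cos(θ_x - θ_{x+e}) = Re χ_Q(e)` for all `x, e`. [folklore] -/
theorem cos_charTexture_sub (Q x e : TorusSite 2 L) :
    Real.cos ((∑ i, latticeMomentum L Q i * ((x i).val : ℝ)) -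
        (∑ i, latticeMomentum L Q i * (((x + e) i).val : ℝ))) = (torusChar Q e).re := by
  have hcos : ∀ a b : ℝ, Real.cos (a - b) =
      (Complex.exp ((a : ℂ) * Complex.I) * conj (Complex.exp ((b : ℂ) * Complex.I))).re := by
    intro a b
    rw [← Complex.exp_conj, map_mul, Complex.conj_I, Complex.conj_ofReal, ← Complex.exp_add]
    have : (a : ℂ) * Complex.I + (b : ℂ) * -Complex.I = ((a - b : ℝ) : ℂ) * Complex.I := by
      push_cast; ring
    rw [this, Complex.exp_ofReal_mul_I_re]
  rw [hcos, ← torusChar_eq_exp', ← torusChar_eq_exp', torusChar_add_right, map_mul, ← mul_assoc,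
    torusChar_mul_conj, one_mul, Complex.conj_re]

/-- **The XY cost of the staggered texture** `θ_x = π(x₀ + x₁)` (`e^{iθ} = χ_Q`, `Q = (L/2, L/2)`,
`L ≥ 3` even): every nearest-neighbour bond is maximally twisted, `Σ_x Σ_{y∼x} (1 - cos(θ_x - θ_y)) = 8L²`. [folklore] -/
theorem xy_stagger (hL : 3 ≤ L) (hLe : Even L) :
    ∑ x : TorusSite 2 L, ∑ y : TorusSite 2 L,
        (if ((y = x + ![1, 0] ∨ y = x + ![-1, 0]) ∨ (y = x + ![0, 1] ∨ y = x + ![0, -1]))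
          then (1 - Real.cos ((∑ i, latticeMomentum L (fun _ : Fin 2 => (((L / 2 : ℕ)) : ZMod L)) i * ((x i).val : ℝ)) -
            (∑ i, latticeMomentum L (fun _ : Fin 2 => (((L / 2 : ℕ)) : ZMod L)) i * ((y i).val : ℝ)))) else 0) =
      8 * ((L ^ 2 : ℕ) : ℝ) := by
  set Q : TorusSite 2 L := fun _ : Fin 2 => (((L / 2 : ℕ)) : ZMod L) with hQ
  obtain ⟨m, hm⟩ := hLe
  have hL0 : L ≠ 0 := NeZero.ne L
  have hm0 : (m : ℝ) ≠ 0 := by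
    have : m ≠ 0 := by rintro rfl; exact hL0 (by simpa using hm)
    exact_mod_cast this
  have hdiv : L / 2 = m := by omega
  have hval : ∀ i, (Q i).val = m := by
    intro i
    simp only [hQ, hdiv]
    rw [ZMod.val_natCast_of_lt (by omega)]
  have hp : ∀ i, latticeMomentum L Q i = Real.pi := by
    intro i
    simp only [latticeMomentum, hval]
    rw [hm]
    push_cast
    field_simp
    ring
  have hchar : ∀ i : Fin 2, (torusChar Q (Pi.single i 1)).re = -1 ∧ (torusChar Q (-Pi.single i 1)).re = -1 := by
    intro i
    have h := torusChar_single_re' Q i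
    rw [hp i, Real.cos_pi] at h
    exact h
  simp_rw [sum_ite_nn_eq hL _ (fun y => 1 - Real.cos ((∑ i, latticeMomentum L Q i * (((_ : TorusSite 2 L) i).val : ℝ)) -
    (∑ i, latticeMomentum L Q i * ((y i).val : ℝ))))]
  simp_rw [cos_charTexture_sub, (hchar 0).1, (hchar 0).2, (hchar 1).1, (hchar 1).2]
  rw [Finset.sum_const, Finset.card_univ, Fintype.card_fun, ZMod.card, Fintype.card_fin]
  push_cast
  ring

/-- **Ceiling on the coercivity constant** (a-priori necessary condition for the crux, crux idea
`sqrt-concavity-multiplier`: `c₀ ≤ κ_L/4`, `κ_L = L⁻² Σ_k |Δ_k|²/E_k`). If the conclusion of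
`BirBdGPhaseCoercivity` holds at `(μ, Δ₁, Δ₂)` with constant `c₀` on an EVEN side `L ≥ 4`, then
`8 c₀ L² ≤ 2 Σ_k |Δ_k|²/E_k`: test the inequality on the staggered texture (`xy_stagger`) and bound
its right-hand side by `deficit_le_two_condensation`. [folklore] -/
theorem ceiling_of_coercive (μ Δ₁ Δ₂ c₀ : ℝ) (hL : 3 ≤ L) (hLe : Even L) (hμ : μ ∈ Set.Ioo (-4 : ℝ) 4)
    (h₁ : Δ₁ ≠ 0) (h₂ : Δ₂ ≠ 0) (ξ E : TorusSite 2 L → ℝ) (Δ : TorusSite 2 L → ℂ)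
    (hξ : ∀ k, ξ k = -2 * Real.cos (latticeMomentum L k 0) - 2 * Real.cos (latticeMomentum L k 1) - μ)
    (hΔ : ∀ k, Δ k = ((2 * Δ₁ * (Real.cos (latticeMomentum L k 0) - Real.cos (latticeMomentum L k 1)) : ℝ) : ℂ) -
        4 * Complex.I * ((Δ₂ * Real.sin (latticeMomentum L k 0) * Real.sin (latticeMomentum L k 1) : ℝ) : ℂ))
    (hE : ∀ k, E k = Real.sqrt (ξ k ^ 2 + ‖Δ k‖ ^ 2))
    (hcoer :
    let nnx : Literature.Probability.LatticeModels.TorusSite 2 L → Literature.Probability.LatticeModels.TorusSite 2 L → Prop := fun x y => y = x + ![1, 0] ∨ y = x + ![-1, 0]; let nny : Literature.Probability.LatticeModels.TorusSite 2 L → Literature.Probability.LatticeModels.TorusSite 2 L → Prop := fun x y => y = x + ![0, 1] ∨ y = x + ![0, -1]; let dg1 : Literature.Probability.LatticeModels.TorusSite 2 L → Literature.Probability.LatticeModels.TorusSite 2 L → Prop := fun x y => y = x + ![1, 1] ∨ y = x + ![-1, -1]; let dg2 : Literature.Probability.LatticeModels.TorusSite 2 L → Literature.Probability.LatticeModels.TorusSite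 2 L → Prop := fun x y => y = x + ![1, -1] ∨ y = x + ![-1, 1]; let h : Matrix (Literature.Probability.LatticeModels.TorusSite 2 L) (Literature.Probability.LatticeModels.TorusSite 2 L) ℂ := fun x y => -(if nnx x y ∨ nny x y then (1 : ℂ) else 0) - (if x = y then (μ : ℂ) else 0); let D : (Literature.Probability.LatticeModels.TorusSite 2 L → ℝ) → Matrix (Literature.Probability.LatticeModels.TorusSite 2 L) (Literature.Probability.LatticeModels.TorusSite 2 L) ℂ := fun θ x y => ((Δ₁ : ℂ) * ((if nnx x y then (1 : ℂ) else 0) - (if nny x y then (1 : ℂ) else 0)) + Complex.I * (Δ₂ : ℂ) * ((if dg1 x y then (1 : ℂ) else 0) - (if dg2 x y then (1 : ℂ) else 0))) * (Complex.exp (Complex.I * (θ x : ℂ)) + Complex.exp (Complex.I * (θ y : ℂ))) / 2; let Hb : (Literature.Probability.LatticeModels.TorusSite 2 L → ℝ) → Matrix (Literature.Probability.LatticeModels.TorusSite 2 L ⊕ Literature.Probability.LatticeModels.TorusSite 2 L) (Literature.Probability.LatticeModels.TorusSite 2 L ⊕ Literature.Probability.LatticeModels.TorusSite 2 L) ℂ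 := fun θ => Matrix.fromBlocks h (D θ) (Matrix.conjTranspose (D θ)) (-h); ∀ θ : Literature.Probability.LatticeModels.TorusSite 2 L → ℝ, ∀ (hθ : (Hb θ).IsHermitian) (h0 : (Hb (fun _ => 0)).IsHermitian), c₀ * ∑ x : Literature.Probability.LatticeModels.TorusSite 2 L, ∑ y : Literature.Probability.LatticeModels.TorusSite 2 L, (if nnx x y ∨ nny x y then (1 - Real.cos (θ x - θ y)) else 0) ≤ ∑ i, |h0.eigenvalues i| - ∑ i, |hθ.eigenvalues i|) :
    c₀ * (8 * ((L ^ 2 : ℕ) : ℝ)) ≤ 2 * ∑ k, ‖Δ k‖ ^ 2 / E k := by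
  set θs : TorusSite 2 L → ℝ := fun x =>
    ∑ i, latticeMomentum L (fun _ : Fin 2 => (((L / 2 : ℕ)) : ZMod L)) i * ((x i).val : ℝ) with hθs
  have hH := hb_isHermitian (L := L) μ Δ₁ Δ₂
  have hlow := hcoer θs (hH θs) (hH fun _ => 0)
  have hup := deficit_le_two_condensation μ Δ₁ Δ₂ hL hμ h₁ h₂ ξ E Δ hξ hΔ hE θs (hH θs) (hH fun _ => 0)
  have hR := xy_stagger (L := L) hL hLe
  simp only [hθs] at hlow
  rw [hR] at hlow
  linarith

/-- **Explicit ceiling**: under the same hypotheses `c₀ ≤ |Δ₁| + |Δ₂|` (since `|Δ_k|²/E_k ≤ |Δ_k| ≤ 4|Δ₁| + 4|Δ₂|`):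
the coercivity constant of the crux necessarily degenerates linearly (in truth quadratically up to a
logarithm, `κ_L/4`) in the pairing amplitudes — the weak-coupling regime `Δ → 0` the route uses. [folklore] -/
theorem ceiling_explicit (μ Δ₁ Δ₂ c₀ : ℝ) (hL : 3 ≤ L) (hLe : Even L) (hμ : μ ∈ Set.Ioo (-4 : ℝ) 4)
    (h₁ : Δ₁ ≠ 0) (h₂ : Δ₂ ≠ 0)
    (hcoer :
    let nnx : Literature.Probability.LatticeModels.TorusSite 2 L → Literature.Probability.LatticeModels.TorusSite 2 L → Prop := fun x y => y = x + ![1, 0] ∨ y = x + ![-1, 0]; let nny : Literature.Probability.LatticeModels.TorusSite 2 L → Literature.Probability.LatticeModels.TorusSite 2 L → Prop := fun x y => y = x + ![0, 1] ∨ y = x + ![0, -1]; let dg1 : Literature.Probability.LatticeModels.TorusSite 2 L → Literature.Probability.LatticeModels.TorusSite 2 L → Prop := fun x y => y = x + ![1, 1] ∨ y = x + ![-1, -1]; let dg2 : Literature.Probability.LatticeModels.TorusSite 2 L → Literature.Probability.LatticeModels.TorusSite 2 L → Prop := fun x y => y = x + ![1, -1] ∨ y = x + ![-1, 1]; let h :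 Matrix (Literature.Probability.LatticeModels.TorusSite 2 L) (Literature.Probability.LatticeModels.TorusSite 2 L) ℂ := fun x y => -(if nnx x y ∨ nny x y then (1 : ℂ) else 0) - (if x = y then (μ : ℂ) else 0); let D : (Literature.Probability.LatticeModels.TorusSite 2 L → ℝ) → Matrix (Literature.Probability.LatticeModels.TorusSite 2 L) (Literature.Probability.LatticeModels.TorusSite 2 L) ℂ := fun θ x y => ((Δ₁ : ℂ) * ((if nnx x y then (1 : ℂ) else 0) - (if nny x y then (1 : ℂ) else 0)) + Complex.I * (Δ₂ : ℂ) * ((if dg1 x y then (1 : ℂ) else 0) - (if dg2 x y then (1 : ℂ) else 0))) * (Complex.exp (Complex.I * (θ x : ℂ)) + Complex.exp (Complex.I * (θ y : ℂ))) / 2; let Hb : (Literature.Probability.LatticeModels.TorusSite 2 L → ℝ) → Matrix (Literature.Probability.LatticeModels.TorusSite 2 L ⊕ Literature.Probability.LatticeModels.TorusSite 2 L) (Literature.Probability.LatticeModels.TorusSite 2 L ⊕ Literature.Probability.LatticeModels.TorusSite 2 L) ℂ := fun θ => Matrix.fromBlocks h (D θ) (Matrix.conjTranspose (D θ)) (-h);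 ∀ θ : Literature.Probability.LatticeModels.TorusSite 2 L → ℝ, ∀ (hθ : (Hb θ).IsHermitian) (h0 : (Hb (fun _ => 0)).IsHermitian), c₀ * ∑ x : Literature.Probability.LatticeModels.TorusSite 2 L, ∑ y : Literature.Probability.LatticeModels.TorusSite 2 L, (if nnx x y ∨ nny x y then (1 - Real.cos (θ x - θ y)) else 0) ≤ ∑ i, |h0.eigenvalues i| - ∑ i, |hθ.eigenvalues i|) :
    c₀ ≤ |Δ₁| + |Δ₂| := by
  set ξ : TorusSite 2 L → ℝ := fun k =>
    -2 * Real.cos (latticeMomentum L k 0) - 2 * Real.cos (latticeMomentum L k 1) - μ with hξ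
  set Δ : TorusSite 2 L → ℂ := fun k =>
    ((2 * Δ₁ * (Real.cos (latticeMomentum L k 0) - Real.cos (latticeMomentum L k 1)) : ℝ) : ℂ) -
      4 * Complex.I * ((Δ₂ * Real.sin (latticeMomentum L k 0) * Real.sin (latticeMomentum L k 1) : ℝ) : ℂ) with hΔ
  set E : TorusSite 2 L → ℝ := fun k => Real.sqrt (ξ k ^ 2 + ‖Δ k‖ ^ 2) with hE
  have hc := ceiling_of_coercive μ Δ₁ Δ₂ c₀ hL hLe hμ h₁ h₂ ξ E Δ (fun _ => rfl) (fun _ => rfl) (fun _ => rfl) hcoer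
  -- `|Δ_k|²/E_k ≤ |Δ_k| ≤ 4|Δ₁| + 4|Δ₂|`
  have hterm : ∀ k, ‖Δ k‖ ^ 2 / E k ≤ 4 * |Δ₁| + 4 * |Δ₂| := by
    intro k
    have hEk : ‖Δ k‖ ≤ E k := by
      rw [hE]
      dsimp only
      calc ‖Δ k‖ = Real.sqrt (‖Δ k‖ ^ 2) := (Real.sqrt_sq (norm_nonneg _)).symm
        _ ≤ Real.sqrt (ξ k ^ 2 + ‖Δ k‖ ^ 2) := Real.sqrt_le_sqrt (by nlinarith [sq_nonneg (ξ k)])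
    have hle : ‖Δ k‖ ^ 2 / E k ≤ ‖Δ k‖ := by
      by_cases hk : ‖Δ k‖ = 0
      · rw [hk]; simp
      · have hpos : 0 < ‖Δ k‖ := lt_of_le_of_ne (norm_nonneg _) (Ne.symm hk)
        rw [div_le_iff₀ (lt_of_lt_of_le hpos hEk), sq]
        exact mul_le_mul_of_nonneg_left hEk hpos.le
    have hbound : ‖Δ k‖ ≤ 4 * |Δ₁| + 4 * |Δ₂| := by
      rw [hΔ]
      dsimp only
      refine (norm_sub_le _ _).trans ?_
      have hc0 := Real.abs_cos_le_one (latticeMomentum L k 0)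
      have hc1 := Real.abs_cos_le_one (latticeMomentum L k 1)
      have hs0 := Real.abs_sin_le_one (latticeMomentum L k 0)
      have hs1 := Real.abs_sin_le_one (latticeMomentum L k 1)
      have t1 : ‖((2 * Δ₁ * (Real.cos (latticeMomentum L k 0) - Real.cos (latticeMomentum L k 1)) : ℝ) : ℂ)‖ ≤
          4 * |Δ₁| := by
        rw [Complex.norm_real, Real.norm_eq_abs, abs_mul, abs_mul, abs_two]
        have : |Real.cos (latticeMomentum L k 0) - Real.cos (latticeMomentum L k 1)| ≤ 2 := by
          have := abs_sub (Real.cos (latticeMomentum L k 0)) (Real.cos (latticeMomentum L k 1)); linarith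
        nlinarith [abs_nonneg Δ₁]
      have t2 : ‖4 * Complex.I * ((Δ₂ * Real.sin (latticeMomentum L k 0) * Real.sin (latticeMomentum L k 1) : ℝ) : ℂ)‖ ≤
          4 * |Δ₂| := by
        rw [norm_mul, norm_mul, Complex.norm_I, mul_one, Complex.norm_real, Real.norm_eq_abs, abs_mul, abs_mul,
          show ‖(4 : ℂ)‖ = 4 by norm_num]
        have h2 : |Real.sin (latticeMomentum L k 0)| * |Real.sin (latticeMomentum L k 1)| ≤ 1 := by
          nlinarith [abs_nonneg (Real.sin (latticeMomentum L k 0)), abs_nonneg (Real.sin (latticeMomentum L k 1))]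
        nlinarith [abs_nonneg Δ₂, abs_nonneg (Real.sin (latticeMomentum L k 0)),
          abs_nonneg (Real.sin (latticeMomentum L k 1))]
      linarith
    exact hle.trans hbound
  have hsum : ∑ k : TorusSite 2 L, ‖Δ k‖ ^ 2 / E k ≤ ((L ^ 2 : ℕ) : ℝ) * (4 * |Δ₁| + 4 * |Δ₂|) := by
    have := Finset.sum_le_sum fun k (_ : k ∈ Finset.univ) => hterm k
    rw [Finset.sum_const, Finset.card_univ, Fintype.card_fun, ZMod.card, Fintype.card_fin, nsmul_eq_mul] at this
    push_cast at this ⊢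
    linarith
  have hN : (0 : ℝ) < ((L ^ 2 : ℕ) : ℝ) := by
    have : 0 < L := Nat.pos_of_ne_zero (NeZero.ne L)
    positivity
  nlinarith

/-- **The crux's constant is at most `|Δ₁| + |Δ₂|`.** For every parameter point `(μ, Δ₁, Δ₂)` and
every pair `(c₀, L₀)` witnessing the conclusion of `BirBdGPhaseCoercivity` from side `L₀` on (the
body of the crux after its existential quantifiers, verbatim), `c₀ ≤ |Δ₁| + |Δ₂|`: evaluate
`ceiling_explicit` at the even side `L = 2·max(L₀,2)`. So the crux's `∃ c₀ > 0` is necessarily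
NON-uniform in the pairing amplitudes: `c₀(μ,Δ₁,Δ₂) → 0` at least linearly as `Δ₁, Δ₂ → 0` (the
weak-coupling regime of the route's dictionary, where the BCS gap is exponentially small). [folklore] -/
theorem birBdG_constant_le (μ Δ₁ Δ₂ c₀ : ℝ) (L₀ : ℕ) (hμ : μ ∈ Set.Ioo (-4 : ℝ) 4)
    (h₁ : Δ₁ ≠ 0) (h₂ : Δ₂ ≠ 0)
    (H : ∀ (L : ℕ) [NeZero L], L₀ ≤ L →
    let nnx : Literature.Probability.LatticeModels.TorusSite 2 L → Literature.Probability.LatticeModels.TorusSite 2 L → Prop := fun x y => y = x + ![1, 0] ∨ y = x + ![-1, 0]; let nny : Literature.Probability.LatticeModels.TorusSite 2 L → Literature.Probability.LatticeModels.TorusSite 2 L → Prop := fun x y => y = x + ![0, 1] ∨ y = x + ![0, -1]; let dg1 : Literature.Probability.LatticeModels.TorusSite 2 L → Literature.Probability.LatticeModels.TorusSite 2 L → Prop := fun x y => y = x + ![1, 1] ∨ y = x + ![-1, -1]; let dg2 : Literature.Probability.LatticeModels.TorusSite 2 L → Literature.Probability.LatticeModels.TorusSite 2 L → Prop := fun x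 y => y = x + ![1, -1] ∨ y = x + ![-1, 1]; let h : Matrix (Literature.Probability.LatticeModels.TorusSite 2 L) (Literature.Probability.LatticeModels.TorusSite 2 L) ℂ := fun x y => -(if nnx x y ∨ nny x y then (1 : ℂ) else 0) - (if x = y then (μ : ℂ) else 0); let D : (Literature.Probability.LatticeModels.TorusSite 2 L → ℝ) → Matrix (Literature.Probability.LatticeModels.TorusSite 2 L) (Literature.Probability.LatticeModels.TorusSite 2 L) ℂ := fun θ x y => ((Δ₁ : ℂ) * ((if nnx x y then (1 : ℂ) else 0) - (if nny x y then (1 : ℂ) else 0)) + Complex.I * (Δ₂ : ℂ) * ((if dg1 x y then (1 : ℂ) else 0) - (if dg2 x y then (1 : ℂ) else 0))) * (Complex.exp (Complex.I * (θ x : ℂ)) + Complex.exp (Complex.I * (θ y : ℂ))) / 2; let Hb : (Literature.Probability.LatticeModels.TorusSite 2 L → ℝ) → Matrix (Literature.Probability.LatticeModels.TorusSite 2 L ⊕ Literature.Probability.LatticeModels.TorusSite 2 L) (Literature.Probability.LatticeModels.TorusSite 2 L ⊕ Literature.Probability.LatticeModels.TorusSite 2 L) ℂ := fun θ => Matrix.fromBlocks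 h (D θ) (Matrix.conjTranspose (D θ)) (-h); ∀ θ : Literature.Probability.LatticeModels.TorusSite 2 L → ℝ, ∀ (hθ : (Hb θ).IsHermitian) (h0 : (Hb (fun _ => 0)).IsHermitian), c₀ * ∑ x : Literature.Probability.LatticeModels.TorusSite 2 L, ∑ y : Literature.Probability.LatticeModels.TorusSite 2 L, (if nnx x y ∨ nny x y then (1 - Real.cos (θ x - θ y)) else 0) ≤ ∑ i, |h0.eigenvalues i| - ∑ i, |hθ.eigenvalues i|) :
    c₀ ≤ |Δ₁| + |Δ₂| := by
  have hne : NeZero (2 * max L₀ 2) := ⟨by omega⟩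
  exact ceiling_explicit (L := 2 * max L₀ 2) μ Δ₁ Δ₂ c₀ (by omega) ⟨max L₀ 2, two_mul _⟩ hμ h₁ h₂
    (H (2 * max L₀ 2) (by omega))

/-- **No parameter-uniform coercivity constant** (the natural strengthening of the crux is FALSE): there is
no single `c₀ > 0` serving every `(μ, Δ₁, Δ₂)` — at `Δ₁ = Δ₂ = c₀/4` the ceiling `c₀ ≤ |Δ₁| + |Δ₂| = c₀/2`
fails. The crux's `∃ c₀` must depend on the pairing amplitudes. [folklore] -/
theorem not_uniform_constant : ¬ ∃ c₀ : ℝ, 0 < c₀ ∧ ∀ (μ Δ₁ Δ₂ : ℝ), μ ∈ Set.Ioo (-4 : ℝ) 4 → Δ₁ ≠ 0 → Δ₂ ≠ 0 → ∃ L₀ : ℕ, ∀ (L : ℕ) [NeZero L], L₀ ≤ L → let nnx : Literature.Probability.LatticeModels.TorusSite 2 L → Literature.Probability.LatticeModels.TorusSite 2 L → Prop := fun x y => y = x + ![1, 0] ∨ y = x + ![-1, 0]; let nny : Literature.Probability.LatticeModels.TorusSite 2 L → Literature.Probability.LatticeModels.TorusSite 2 L → Prop := fun x y => y = x + ![0,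 1] ∨ y = x + ![0, -1]; let dg1 : Literature.Probability.LatticeModels.TorusSite 2 L → Literature.Probability.LatticeModels.TorusSite 2 L → Prop := fun x y => y = x + ![1, 1] ∨ y = x + ![-1, -1]; let dg2 : Literature.Probability.LatticeModels.TorusSite 2 L → Literature.Probability.LatticeModels.TorusSite 2 L → Prop := fun x y => y = x + ![1, -1] ∨ y = x + ![-1, 1]; let h : Matrix (Literature.Probability.LatticeModels.TorusSite 2 L) (Literature.Probability.LatticeModels.TorusSite 2 L) ℂ := fun x y => -(if nnx x y ∨ nny x y then (1 : ℂ) else 0) - (if x = y then (μ : ℂ) else 0); let D : (Literature.Probability.LatticeModels.TorusSite 2 L → ℝ) → Matrix (Literature.Probability.LatticeModels.TorusSite 2 L) (Literature.Probability.LatticeModels.TorusSite 2 L) ℂ := fun θ x y => ((Δ₁ : ℂ) * ((if nnx x y then (1 : ℂ) else 0) - (if nny x y then (1 : ℂ) else 0)) + Complex.I * (Δ₂ : ℂ) * ((if dg1 x y then (1 : ℂ) else 0) - (if dg2 x y then (1 : ℂ) else 0))) * (Complex.exp (Complex.I * (θ x : ℂ)) + Complex.exp (Complex.I * (θ y : ℂ)))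 / 2; let Hb : (Literature.Probability.LatticeModels.TorusSite 2 L → ℝ) → Matrix (Literature.Probability.LatticeModels.TorusSite 2 L ⊕ Literature.Probability.LatticeModels.TorusSite 2 L) (Literature.Probability.LatticeModels.TorusSite 2 L ⊕ Literature.Probability.LatticeModels.TorusSite 2 L) ℂ := fun θ => Matrix.fromBlocks h (D θ) (Matrix.conjTranspose (D θ)) (-h); ∀ θ : Literature.Probability.LatticeModels.TorusSite 2 L → ℝ, ∀ (hθ : (Hb θ).IsHermitian) (h0 : (Hb (fun _ => 0)).IsHermitian), c₀ * ∑ x : Literature.Probability.LatticeModels.TorusSite 2 L, ∑ y : Literature.Probability.LatticeModels.TorusSite 2 L, (if nnx x y ∨ nny x y then (1 - Real.cos (θ x - θ y)) else 0) ≤ ∑ i, |h0.eigenvalues i| - ∑ i, |hθ.eigenvalues i| := by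
  rintro ⟨c₀, hc₀, H⟩
  have hμ : (0 : ℝ) ∈ Set.Ioo (-4 : ℝ) 4 := by constructor <;> norm_num
  have hq : c₀ / 4 ≠ 0 := by positivity
  obtain ⟨L₀, hL₀⟩ := H 0 (c₀ / 4) (c₀ / 4) hμ hq hq
  have hle := birBdG_constant_le 0 (c₀ / 4) (c₀ / 4) c₀ L₀ hμ hq hq (fun L _ hL => hL₀ L hL)
  rw [abs_of_pos (by positivity : (0 : ℝ) < c₀ / 4)] at hle
  linarith

end Typed

end BirBdG

end Summit.HubbardSuperconductivity.HubbardSuperconductivity.Theorems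

end
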